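import Mathlib
import HarnessLib
import Summits.HubbardSuperconductivity.HubbardSuperconductivity.Theorems.KLProgrammeKLRegimeCountertermContinuation
import Summits.HubbardSuperconductivity.HubbardSuperconductivity.Theorems.KLProgrammeKLRegimeCountertermReadingRegime
import Summits.HubbardSuperconductivity.HubbardSuperconductivity.Theorems.KLProgrammeKLRegimeCountertermPicardReading
import Summits.HubbardSuperconductivity.HubbardSuperconductivity.Theorems.KLProgrammeKLRegimeCountertermMsThresholds

/-!
# Route `KLProgramme` — child `KLRegimeCountertermV11 := CountertermP2 klPredsV11 klWindowC` (stmt-HubbardSuperconductivity-19825):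
# THE ONE-VOLUME CONSTRUCTION `CtOneVolumeMsV11 G P Q` — PROVED (seat hubbard-kl-k3c3-p2; «fixed point on FrameOK's tube»)

Assembly of the registered stub's statement from the pieces landed by the Counterterm lane:
* the WHOLESALE CONTINUATION at one volume (`ct_oneVolume_of_reading`, this seat: one Picard step per scale, self-map by (E3a-MS) /
  `frameOK_of_multiSlot`, contraction by (E3c), renormalisation by reading);
* the READING inequality keyed by `FrameOK` in the regime (k3c3-p1 `abs_klLocalPart_le_of_partialSum_frameOK`, on k3c3-p3/p1b's wiggle
  and frame-curve geometry), with `Λ_ν` from (E3g) (`TwoLegAngularG.abs_sub_le`) and `Λ_ℓ` from (E3a) `j = 1`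
  (k3c3-p1 `abs_partialSum_sub_le_of_sizes` / `sum_twoLegBar_one_le`) — packaged here as `ct_reading_of_block`;
* the THRESHOLDS of the self-map at child 2's package `ctRenMs G` (p2 `ctRenMs_thresholds`) and the construction volume
  (p2 `exists_volume_threshold`).
Order of choices: `c₁ := min c₂ c₃`; `U₀ :=` the minimum of the reading's and p2's thresholds and two explicit reciprocals (`Q.S′ 0·U ≤ 1/10`,
contraction `(4/3)(SL+SL′U)U ≤ 1/1000`); then, given `(μ, U, β, Lh, Mh)` and the block, ONE volume `L₀ ≥ max(Lh, 503)` with `2π/L₀ < r₀`, the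
wiggle slack `W/L₀ ≤ |U|·16^{-n}/256` and the volume rate `Q.CL β n/L₀ ≤ ½tol_n` for `n ≤ nScales β`, and `M₀ := max (Mh L₀) (Q.M0 β L₀) + 1`.
Proofs only; nothing is asserted about the Hubbard model beyond the hypothesis block.
-/

noncomputable section

namespace Summit.HubbardSuperconductivity.HubbardSuperconductivity.Theorems.KLRegimeSplit

set_option linter.dupNamespace false -- summit = problem name (single-conjunct summit), D-0017

open Real Finset
open Literature.MathematicalPhysics.QuantumLattice Literature.Probability.LatticeModels
open Summit.HubbardSuperconductivity.HubbardSuperconductivity.Theorems.KLProgrammeLegKernels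

/-! ## §1 Small numeric lemmas -/

/-- `8π/klFlatR ≤ 503` (`klFlatR = 1/20`, `160π < 502.7`). -/
theorem eight_pi_div_klFlatR_le : 8 * π / klFlatR ≤ (503 : ℝ) := by
  unfold klFlatR
  have := Real.pi_lt_d4
  rw [div_le_iff₀ (by norm_num)]
  nlinarith

/-- `Q.S′ 0·|U| ≤ 1/10` once `0 < U ≤ 1/(10(Q.S′ 0 + 1))`. -/
theorem sPrime_zero_mul_abs_le {S' U : ℝ} (hS' : 0 ≤ S') (hU : 0 < U) (hUle : U ≤ 1 / (10 * (S' + 1))) : S' * |U| ≤ 1 / 10 := by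
  rw [abs_of_pos hU]
  have h1 : S' * U ≤ S' * (1 / (10 * (S' + 1))) := mul_le_mul_of_nonneg_left hUle hS'
  have h2 : S' * (1 / (10 * (S' + 1))) ≤ 1 / 10 := by
    rw [mul_one_div, div_le_div_iff₀ (by positivity) (by norm_num)]
    nlinarith
  linarith

/-- The contraction condition `(4/3)(SL + SL′|U|)|U| ≤ 1/1000` once `0 < U ≤ min 1 (3/(4000(SL+SL′+1)))`. -/
theorem contraction_le {SL SL' U : ℝ} (hSL : 0 ≤ SL) (hSL' : 0 ≤ SL') (hU : 0 < U) (hU1 : U ≤ 1)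
    (hUle : U ≤ 3 / (4000 * (SL + SL' + 1))) : 4 / 3 * (SL + SL' * |U|) * |U| ≤ 1 / 1000 := by
  rw [abs_of_pos hU]
  have h1 : SL + SL' * U ≤ SL + SL' + 1 := by nlinarith
  have h2 : (SL + SL' + 1) * U ≤ 3 / 4000 := by
    have := mul_le_mul_of_nonneg_left hUle (by positivity : (0 : ℝ) ≤ SL + SL' + 1)
    rw [mul_div_assoc', div_eq_mul_inv] at this
    have hne : (4000 * (SL + SL' + 1)) ≠ 0 := by positivity
    calc (SL + SL' + 1) * U ≤ (SL + SL' + 1) * (3 / (4000 * (SL + SL' + 1))) :=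
          mul_le_mul_of_nonneg_left hUle (by positivity)
      _ = 3 / 4000 := by field_simp
  have h4 : (SL + SL' * U) * U ≤ (SL + SL' + 1) * U := mul_le_mul_of_nonneg_right h1 hU.le
  nlinarith

/-- `2π/L < r₀` once `2π/r₀ < Lr` and `Lr + 1 ≤ L`. -/
theorem two_pi_div_lt_of_floor {r₀ : ℝ} (hr₀ : 0 < r₀) {Lr L : ℕ} (hLr : 2 * π / r₀ < Lr) (hL : Lr + 1 ≤ L) :
    2 * π / (L : ℝ) < r₀ := by
  have hLrR : (Lr : ℝ) + 1 ≤ L := by exact_mod_cast hL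
  have hLpos : (0 : ℝ) < L := by have : (0 : ℝ) ≤ Lr := Nat.cast_nonneg _; linarith
  rw [div_lt_iff₀ hLpos]
  have h := (div_lt_iff₀ hr₀).mp hLr
  nlinarith

/-! ## §2 The reading hypothesis of the continuation, from the block -/

section Reading

variable {L M : ℕ} [NeZero L] [NeZero M] {G : GeoConsts} {P : SplitConsts} {Q : EngConsts} {β U μ : ℝ}

/-- **THE READING OF THE CONTINUATION, from the V11 block and the frame-keyed reading inequality.**  Given the conclusion of
`abs_klLocalPart_le_of_partialSum_frameOK` at these parameters (binders `n, Λ_ν, Λ_ℓ, θ` left open: `rd`), the block at `(L, M)` supplies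
`Λ_ν = angBar … 1` ((E3g)) and `Λ_ℓ = Σ_{i≤n} twoLegBar 1 i ≤ (4/3)(S 1+S′ 1|U|)U²` ((E3a) `j = 1`) for every admissible frame renormalised
below `n`; so a sup bound `B` of the partial sum gives `|ν_n(K)(θ)| ≤ B + W/L` with the frame/scale-free
`W = (4/3)(S 1+S′ 1|U|)U²·2π + (angBar … 1 + Λ_K)·π·(2π/r₀)`. -/
theorem ct_reading_of_block (hG : G.WF) (hQ : Q.WF)
    (blk : ∀ K : TrigPolyC4v, FrameOK (ctRenMs G) U (nScales β) μ K → ∀ n : ℕ, n ≤ nScales β →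
      (∀ j < n, RenormalisedAtF L M β U μ K (ctRenMs G) j) →
        EngineBoundsAtV7S L M G P Q β U μ K n ∧ TwoLegStepV11 L M G P Q (ctRenMs G) β U μ K n ∧ BetaSplitAtS2 L M G P Q β U μ K n)
    {ΛK r₀ : ℝ} (hr₀ : 0 < r₀)
    (rd : ∀ K : TrigPolyC4v, FrameOK (ctRenMs G) U (nScales β) μ K → ∀ (n : ℕ) (Λν : ℝ), 0 ≤ Λν →
      (∀ a' b', |klLocalPart L M β U μ K n a' - klLocalPart L M β U μ K n b'| ≤ Λν * |a' - b'|) →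
      ∀ Λℓ : ℝ, 0 ≤ Λℓ →
        (∀ p p' : Fin 2 → ℝ, |∑ i ∈ range (n + 1), (klTwoLegPieceG L M β U μ K i).eval p -
          ∑ i ∈ range (n + 1), (klTwoLegPieceG L M β U μ K i).eval p'| ≤ Λℓ * (|p 0 - p' 0| + |p 1 - p' 1|)) →
      ∀ θ : ℝ, |klLocalPart L M β U μ K n θ| ≤
        |K.eval (klFermiPoint μ K θ) + ∑ i ∈ range (n + 1), (klTwoLegPieceG L M β U μ K i).eval (klFermiPoint μ K θ)| +
          (Λℓ * (2 * π / L) + (Λν + ΛK) * π * (2 * (π / L) / r₀)))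
    {K : TrigPolyC4v} (hK : FrameOK (ctRenMs G) U (nScales β) μ K) {n : ℕ} (hn : n ≤ nScales β)
    (hren : ∀ j < n, RenormalisedAtF L M β U μ K (ctRenMs G) j) {B : ℝ}
    (hB : ∀ q : Fin 2 → ℝ, |K.eval q + ∑ i ∈ range (n + 1), (klTwoLegPieceG L M β U μ K i).eval q| ≤ B) (θ : ℝ) :
    |klLocalPart L M β U μ K n θ| ≤ B +
      (4 / 3 * (G.S 1 + Q.S' 1 * |U|) * U ^ 2 * (2 * π) + (angBar G Q (ctRenMs G) U (nScales β) 1 + ΛK) * π * (2 * π / r₀)) / L := by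
  have hRWF : (ctRenMs G).WF := (ctRenMs_WF2 hG).1
  have hS1 : 0 ≤ G.S 1 := hG.2.2.2.2.2.2.2.2.2.2.2.2.2.2.2.2.2.1 1
  have hS'1 : 0 ≤ Q.S' 1 := hQ.2.2.2.2.1 1
  have hLpos : (0 : ℝ) < L := Nat.cast_pos.2 (Nat.pos_of_ne_zero (NeZero.ne L))
  have hslot := blk K hK n hn hren
  have hang : TwoLegAngularG L M G Q (ctRenMs G) β U μ K n := hslot.2.1.2.2.1
  have hΛν0 : 0 ≤ angBar G Q (ctRenMs G) U (nScales β) 1 := angBar_nonneg hG hQ hRWF U (nScales β) 1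
  have hsizes : ∀ i ≤ n, TwoLegSizesG L M G Q (ctRenMs G) β U μ K i := fun i hi =>
    (blk K hK i (hi.trans hn) fun j hj => hren j (lt_of_lt_of_le hj hi)).2.1.1.1
  have hΛℓ'0 : 0 ≤ ∑ i ∈ range (n + 1), twoLegBar G Q U 1 i := sum_nonneg fun i _ => twoLegBar_nonneg' hG hQ U 1 i
  have hΛℓ'le : ∑ i ∈ range (n + 1), twoLegBar G Q U 1 i ≤ 4 / 3 * (G.S 1 + Q.S' 1 * |U|) * U ^ 2 :=
    sum_twoLegBar_one_le G Q U (by positivity) (n + 1)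
  have hmain := rd K hK n _ hΛν0 (fun a b => hang.abs_sub_le a b) _ hΛℓ'0 (abs_partialSum_sub_le_of_sizes (L := L) (M := M) hsizes) θ
  have hBq := hB (klFermiPoint μ K θ)
  have hπL : 0 ≤ 2 * π / (L : ℝ) := by positivity
  have h1 : (∑ i ∈ range (n + 1), twoLegBar G Q U 1 i) * (2 * π / L) ≤ 4 / 3 * (G.S 1 + Q.S' 1 * |U|) * U ^ 2 * (2 * π / L) :=
    mul_le_mul_of_nonneg_right hΛℓ'le hπL
  have e : (4 / 3 * (G.S 1 + Q.S' 1 * |U|) * U ^ 2 * (2 * π) + (angBar G Q (ctRenMs G) U (nScales β) 1 + ΛK) * π * (2 * π / r₀)) / L =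
      4 / 3 * (G.S 1 + Q.S' 1 * |U|) * U ^ 2 * (2 * π / L) +
        (angBar G Q (ctRenMs G) U (nScales β) 1 + ΛK) * π * (2 * (π / L) / r₀) := by
    field_simp
  rw [e]
  linarith

end Reading

/-! ## §3 The one-volume construction -/

/-- **THE ONE-VOLUME CONSTRUCTION OF THE COUNTERTERM CHILD (gen 3) — PROVED.** -/
theorem ctOneVolumeMsV11_holds (G : GeoConsts) (P : SplitConsts) (Q : EngConsts) (hG : G.WF) (_hP : P.WF) (hQ : Q.WF) :
    CtOneVolumeMsV11 G P Q := by
  have hR : ∀ j, 0 ≤ (ctRenMs G).Gfr j := (ctRenMs_WF2 hG).1.2.2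
  have hRWF : (ctRenMs G).WF := (ctRenMs_WF2 hG).1
  have hS0 : 0 ≤ G.S 0 := hG.2.2.2.2.2.2.2.2.2.2.2.2.2.2.2.2.2.1 0
  have hS1 : 0 ≤ G.S 1 := hG.2.2.2.2.2.2.2.2.2.2.2.2.2.2.2.2.2.1 1
  have hS'0 : 0 ≤ Q.S' 0 := hQ.2.2.2.2.1 0
  have hS'1 : 0 ≤ Q.S' 1 := hQ.2.2.2.2.1 1
  have hSL : 0 ≤ G.SL := hG.2.2.2.2.2.2.2.2.2.2.2.2.2.2.2.2.2.2.2
  have hSL' : 0 ≤ Q.SL := hQ.2.2.2.2.2.2.1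
  have hCL : ∀ β n, 0 ≤ Q.CL β n := hQ.2.2.2.2.2.2.2
  -- the thresholds of the self-map and of the reading
  obtain ⟨c₂, hc₂, U₂, hU₂, thr⟩ := ctRenMs_thresholds (G := G) (Q := Q) hG hQ
  obtain ⟨c₃, hc₃, U₃, hU₃, ΛK, hΛK, r₀, hr₀, read⟩ := abs_klLocalPart_le_of_partialSum_frameOK (ctRenMs G) hR
  refine ⟨min c₂ c₃, lt_min hc₂ hc₃, fun c hc hcle => ?_⟩
  have hu₄pos : 0 < 1 / (10 * (Q.S' 0 + 1)) := by positivity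
  have hu₅pos : 0 < 3 / (4000 * (G.SL + Q.SL + 1)) := by positivity
  refine ⟨min (min U₂ U₃) (min (min (1 / (10 * (Q.S' 0 + 1))) (3 / (4000 * (G.SL + Q.SL + 1)))) 1),
    lt_min (lt_min hU₂ hU₃) (lt_min (lt_min hu₄pos hu₅pos) one_pos), ?_⟩
  intro μ hμ U hU hUle β hβ hβc Lh Mh hyp
  have hU2 : U ≤ U₂ := hUle.trans ((min_le_left _ _).trans (min_le_left _ _))
  have hU3 : U ≤ U₃ := hUle.trans ((min_le_left _ _).trans (min_le_right _ _))
  have hU4 : U ≤ 1 / (10 * (Q.S' 0 + 1)) := hUle.trans ((min_le_right _ _).trans ((min_le_left _ _).trans (min_le_left _ _)))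
  have hU5 : U ≤ 3 / (4000 * (G.SL + Q.SL + 1)) :=
    hUle.trans ((min_le_right _ _).trans ((min_le_left _ _).trans (min_le_right _ _)))
  have hU1 : U ≤ 1 := hUle.trans ((min_le_right _ _).trans (min_le_right _ _))
  have hS0' : Q.S' 0 * |U| ≤ 1 / 10 := sPrime_zero_mul_abs_le hS'0 hU hU4
  have hq : 4 / 3 * (G.SL + Q.SL * |U|) * |U| ≤ 1 / 1000 := contraction_le hSL hSL' hU hU1 hU5
  obtain ⟨hroomA, hroomB, h0, h1, h2⟩ := thr c U β hc.le (hcle.trans (min_le_left _ _)) hU hU2 hβ hβc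
  -- the wiggle budget and the construction volume
  set W : ℝ := 4 / 3 * (G.S 1 + Q.S' 1 * |U|) * U ^ 2 * (2 * π) +
    (angBar G Q (ctRenMs G) U (nScales β) 1 + ΛK) * π * (2 * π / r₀) with hW
  have hW0 : 0 ≤ W := by
    have := angBar_nonneg hG hQ hRWF U (nScales β) 1
    rw [hW]; positivity
  obtain ⟨Lr, hLr⟩ := exists_nat_gt (2 * π / r₀)
  have htpos : ∀ n ≤ nScales β,
      0 < min (|U| * ((16 : ℝ) ^ n)⁻¹ / 256) (ctCr G * |U| * klScale klE0 n ^ 2 / klE0 / 2) := by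
    intro n _
    have hUa : 0 < |U| := abs_pos.2 hU.ne'
    have hcr0 : 0 < ctCr G := by unfold ctCr; positivity
    have he0 : (0 : ℝ) < klE0 := by norm_num [klE0]
    have hΛ : 0 < klScale klE0 n := by unfold klScale; positivity
    exact lt_min (by positivity) (by positivity)
  obtain ⟨L₀, hL₀pos, hL₀min, hL₀rate⟩ :=
    exists_volume_threshold (N := nScales β) (a := fun n => W + Q.CL β n)
      (t := fun n => min (|U| * ((16 : ℝ) ^ n)⁻¹ / 256) (ctCr G * |U| * klScale klE0 n ^ 2 / klE0 / 2))
      (fun n _ => add_nonneg hW0 (hCL β n)) htpos (max Lh (max 503 (Lr + 1)))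
  have hLh : Lh ≤ L₀ := (le_max_left _ _).trans hL₀min
  have h503 : 503 ≤ L₀ := ((le_max_left _ _).trans (le_max_right _ _)).trans hL₀min
  have hLrL : Lr + 1 ≤ L₀ := ((le_max_right _ _).trans (le_max_right _ _)).trans hL₀min
  have hL₀R : (503 : ℝ) ≤ L₀ := by exact_mod_cast h503
  have hL₀posR : (0 : ℝ) < L₀ := by linarith
  have h20 : (20 : ℝ) ≤ L₀ := by linarith
  have hflat : 8 * π / klFlatR ≤ L₀ := eight_pi_div_klFlatR_le.trans hL₀R
  have hLu : 2 * π / (L₀ : ℝ) < r₀ := two_pi_div_lt_of_floor hr₀ hLr hLrL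
  have hM₀pos : 0 < max (Mh L₀) (Q.M0 β L₀) + 1 := Nat.succ_pos _
  haveI : NeZero L₀ := ⟨Nat.pos_iff_ne_zero.mp hL₀pos⟩
  haveI : NeZero (max (Mh L₀) (Q.M0 β L₀) + 1) := ⟨Nat.pos_iff_ne_zero.mp hM₀pos⟩
  have hMh : Mh L₀ ≤ max (Mh L₀) (Q.M0 β L₀) + 1 := (le_max_left _ _).trans (Nat.le_succ _)
  have hM0' : Q.M0 β L₀ ≤ max (Mh L₀) (Q.M0 β L₀) + 1 := (le_max_right _ _).trans (Nat.le_succ _)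
  -- the block at the construction volume
  have blk := ctBlockAt_of_ctHypMsV11 (L := L₀) (M := max (Mh L₀) (Q.M0 β L₀) + 1) hyp hLh hMh
  -- the two families of rates fit
  have hsplit : ∀ n ≤ nScales β, W / L₀ ≤ |U| * ((16 : ℝ) ^ n)⁻¹ / 256 ∧
      Q.CL β n / L₀ ≤ ctCr G * |U| * klScale klE0 n ^ 2 / klE0 / 2 := by
    intro n hn
    have h := hL₀rate n hn
    have hWle : W / (L₀ : ℝ) ≤ (W + Q.CL β n) / L₀ := div_le_div_of_nonneg_right (by linarith [hCL β n]) hL₀posR.le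
    have hCle : Q.CL β n / (L₀ : ℝ) ≤ (W + Q.CL β n) / L₀ := div_le_div_of_nonneg_right (by linarith) hL₀posR.le
    exact ⟨(hWle.trans h).trans (min_le_left _ _), (hCle.trans h).trans (min_le_right _ _)⟩
  -- the reading at the construction volume
  have hread : ∀ K : TrigPolyC4v, FrameOK (ctRenMs G) U (nScales β) μ K → ∀ n : ℕ, n ≤ nScales β →
      (∀ j < n, RenormalisedAtF L₀ (max (Mh L₀) (Q.M0 β L₀) + 1) β U μ K (ctRenMs G) j) → ∀ B : ℝ,
        (∀ q : Fin 2 → ℝ, |K.eval q + ∑ i ∈ range (n + 1),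
          (klTwoLegPieceG L₀ (max (Mh L₀) (Q.M0 β L₀) + 1) β U μ K i).eval q| ≤ B) →
          ∀ θ : ℝ, |klLocalPart L₀ (max (Mh L₀) (Q.M0 β L₀) + 1) β U μ K n θ| ≤ B + W / L₀ := by
    intro K hK n hn hren B hB θ
    exact ct_reading_of_block (L := L₀) (M := max (Mh L₀) (Q.M0 β L₀) + 1) hG hQ blk hr₀
      (fun K hK n Λν hΛν hLip Λℓ hΛℓ hLipℓ θ =>
        read c hc (hcle.trans (min_le_right _ _)) U hU hU3 β hβ hβc μ hμ K hK L₀ _ h20 hflat hLu n Λν hΛν hLip Λℓ hΛℓ hLipℓ θ)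
      hK hn hren hB θ
  -- the continuation
  obtain ⟨K, hK, hhalf⟩ := ct_oneVolume_of_reading (L := L₀) (M := max (Mh L₀) (Q.M0 β L₀) + 1) (fun _ => W / L₀) hG hQ hμ hR rfl
    blk hread (fun n hn => (hsplit n hn).1) hS0' hq hroomA hroomB h0 h1 h2
  refine ⟨K, hK, L₀, max (Mh L₀) (Q.M0 β L₀) + 1, hL₀pos, hM₀pos, hLh, hMh, hM0', fun _ _ n hn => ⟨fun θ => ?_, (hsplit n hn).2⟩⟩
  exact hhalf n hn θ

end Summit.HubbardSuperconductivity.HubbardSuperconductivity.Theorems.KLRegimeSplit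

end
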